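import Mathlib.Analysis.Calculus.Deriv.MeanValue
import Mathlib.Analysis.Calculus.Deriv.Polynomial
import Mathlib.Analysis.Calculus.Deriv.Inv
import Literature.Computability.QuantumComplexity.AaronsonAmbainis

/-!
# Crux `VarianceAmplification` (stmt-QuantumAdvantage-17874, route RandomOracleGauge), line `average-and-clip` — stub `stub_outerPoly`

The OUTER CLIPPING POLYNOMIALS of the elementary variance amplifier (line card
`Cruxes/AAConj/Lines/average-and-clip.md`): for every gain `k ≥ 1` an explicit `S ∈ ℝ[u]` of degree `≤ 3k²`,
bounded by `1` on `[−1,1]`, `2k`-Lipschitz there, increasing with slope `≥ 1/64`, and slope `≥ k/16` on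
`|u| ≤ 1/(2k)`. We use the SOFT SIGN

  `T(u) = Σ_{j≤n} C(n,j) (−1)^j u^{2j+1}/(2j+1)`  (`T' = (1 − u²)^n`, `T(0) = 0`, `T` odd),  `n = k²`,

and `S = (63k/128)·T + u/64`. On `[−1,1]`: `0 ≤ T' ≤ 1`, so `1/64 ≤ S' ≤ 63k/128 + 1/64 ≤ 2k`; on `|u| ≤ 1/(2k)`
Bernoulli gives `T' ≥ 1 − k²u² ≥ 3/4`, so `S' ≥ k/16`; and `|T| ≤ T(1) ≤ 2/k` (slope `≤ 1` on `[0,1/k]`, and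
on `[1/k, 1]` the function `T(v) + 1/(k²v)` is non-increasing because `(1−v²)^{k²} ≤ 1/(1+k²v²) ≤ 1/(k²v²)`),
whence `|S| ≤ 63/64 + 1/64 = 1`. All slope statements are transported by the mean value theorem
(`Convex.mul_sub_le_image_sub_of_le_deriv` / `image_sub_le_mul_sub_of_deriv_le`).

**`stub_outerPoly`** — the registered stub, BY NAME, with `(κ, K) = (2, 3)`. Elementary real analysis over
Mathlib; no named facts, no new definitions.
-/

-- D-0017: single-conjunct summit ⇒ the duplicate `QuantumAdvantage.QuantumAdvantage` is mandated.
set_option linter.dupNamespace false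

noncomputable section

open Finset Polynomial Set

namespace Summit.QuantumAdvantage.QuantumAdvantage.Cruxes.VarianceAmplification.AverageAndClip

namespace StubOuterPoly

/-! ### The soft sign `T_n` -/

/-- `T_n' = (1 − X²)^n`. [folklore] -/
theorem derivative_softSign (n : ℕ) :
    derivative (∑ j ∈ Finset.range (n + 1),
        C (((n.choose j : ℕ) : ℝ) * (-1) ^ j / (2 * j + 1)) * X ^ (2 * j + 1) : ℝ[X]) =
      (1 - X ^ 2) ^ n := by
  rw [derivative_sum]
  have hbin : ((1 : ℝ[X]) - X ^ 2) ^ n =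
      ∑ j ∈ Finset.range (n + 1), (-X ^ 2) ^ j * 1 ^ (n - j) * ((n.choose j : ℕ) : ℝ[X]) := by
    rw [sub_eq_neg_add, add_pow]
  rw [hbin]
  refine Finset.sum_congr rfl fun j _ => ?_
  rw [derivative_C_mul_X_pow, Nat.add_sub_cancel, one_pow, mul_one, neg_pow (X ^ 2 : ℝ[X]) j, ← pow_mul]
  have h : ((n.choose j : ℕ) : ℝ) * (-1) ^ j / (2 * j + 1) * ((2 * j + 1 : ℕ) : ℝ) =
      ((n.choose j : ℕ) : ℝ) * (-1) ^ j := by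
    have : (2 * (j : ℝ) + 1) ≠ 0 := by positivity
    push_cast
    field_simp
  rw [h, map_mul, map_pow, map_neg, map_one, map_natCast]
  ring

/-- `T_n(0) = 0`. [folklore] -/
theorem softSign_eval_zero (n : ℕ) :
    (∑ j ∈ Finset.range (n + 1),
        C (((n.choose j : ℕ) : ℝ) * (-1) ^ j / (2 * j + 1)) * X ^ (2 * j + 1) : ℝ[X]).eval 0 = 0 := by
  rw [eval_finsetSum]
  refine Finset.sum_eq_zero fun j _ => ?_
  simp

/-- `T_n` is odd. [folklore] -/
theorem softSign_eval_neg (n : ℕ) (u : ℝ) :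
    (∑ j ∈ Finset.range (n + 1),
        C (((n.choose j : ℕ) : ℝ) * (-1) ^ j / (2 * j + 1)) * X ^ (2 * j + 1) : ℝ[X]).eval (-u) =
      -(∑ j ∈ Finset.range (n + 1),
        C (((n.choose j : ℕ) : ℝ) * (-1) ^ j / (2 * j + 1)) * X ^ (2 * j + 1) : ℝ[X]).eval u := by
  rw [eval_finsetSum, eval_finsetSum, ← Finset.sum_neg_distrib]
  refine Finset.sum_congr rfl fun j _ => ?_
  rw [eval_mul, eval_C, eval_pow, eval_X, eval_mul, eval_C, eval_pow, eval_X,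
    Odd.neg_pow ⟨j, rfl⟩]
  ring

/-- `deg T_n ≤ 2n + 1`. [folklore] -/
theorem natDegree_softSign_le (n : ℕ) :
    (∑ j ∈ Finset.range (n + 1),
        C (((n.choose j : ℕ) : ℝ) * (-1) ^ j / (2 * j + 1)) * X ^ (2 * j + 1) : ℝ[X]).natDegree ≤ 2 * n + 1 := by
  refine natDegree_sum_le_of_forall_le _ _ fun j hj => ?_
  rw [Finset.mem_range] at hj
  exact (natDegree_C_mul_X_pow_le _ _).trans (by omega)

/-! ### Two elementary inequalities -/

/-- Bernoulli on the zone: `(1 − u²)^n ≥ 3/4` for `n u² ≤ 1/4`, `u² ≤ 1`. [folklore] -/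
theorem zone_pow_ge {n : ℕ} {u : ℝ} (hu2 : u ^ 2 ≤ 1) (hnu : (n : ℝ) * u ^ 2 ≤ 1 / 4) : 3 / 4 ≤ (1 - u ^ 2) ^ n := by
  have hB := one_add_mul_le_pow (show (-2 : ℝ) ≤ -u ^ 2 by nlinarith) n
  have : (1 : ℝ) + -u ^ 2 = 1 - u ^ 2 := by ring
  rw [this] at hB
  nlinarith

/-- The tail comparison: on `[a, 1]` with `0 < a` and `n a'² ≥ …`, precisely for `v ≥ a > 0` with `1 ≤ n v²`-free form:
`(1 − v²)^n ≤ 1/(n v²)` for `0 < v ≤ 1`, `1 ≤ n`. [folklore] -/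
theorem pow_le_inv {n : ℕ} {v : ℝ} (hv0 : 0 < v) (hv1 : v ≤ 1) (hn : 1 ≤ n) : (1 - v ^ 2) ^ n ≤ 1 / ((n : ℝ) * v ^ 2) := by
  have hB := one_add_mul_le_pow (show (-2 : ℝ) ≤ v ^ 2 by nlinarith) n
  have h0 : 0 ≤ 1 - v ^ 2 := by nlinarith
  have hprod : (1 - v ^ 2) ^ n * (1 + v ^ 2) ^ n ≤ 1 := by
    rw [← mul_pow]
    have : (1 - v ^ 2) * (1 + v ^ 2) = 1 - v ^ 4 := by ring
    rw [this]
    have hv4 : v ^ 4 ≤ 1 := pow_le_one₀ hv0.le hv1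
    have hv4' : 0 ≤ v ^ 4 := by positivity
    exact pow_le_one₀ (by linarith) (by linarith)
  have hnv : 0 < (n : ℝ) * v ^ 2 := by
    have : (1 : ℝ) ≤ n := by exact_mod_cast hn
    positivity
  rw [le_div_iff₀ hnv]
  calc (1 - v ^ 2) ^ n * ((n : ℝ) * v ^ 2) ≤ (1 - v ^ 2) ^ n * (1 + (n : ℝ) * v ^ 2) :=
        mul_le_mul_of_nonneg_left (by linarith) (pow_nonneg h0 n)
    _ ≤ (1 - v ^ 2) ^ n * (1 + v ^ 2) ^ n := mul_le_mul_of_nonneg_left hB (pow_nonneg h0 n)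
    _ ≤ 1 := hprod

/-! ### Calculus facts for a polynomial `T` with `T' = (1 − X²)^n`, `T(0) = 0` -/

section softSignFacts

variable {n : ℕ} {T : ℝ[X]} (hT : derivative T = (1 - X ^ 2) ^ n)
include hT

/-- The derivative of `u ↦ T(u)` is `(1 − u²)^n`. [folklore] -/
theorem deriv_T (u : ℝ) : deriv (fun x => T.eval x) u = (1 - u ^ 2) ^ n := by
  rw [Polynomial.deriv, hT]; simp

/-- `0 ≤ T' ≤ 1` on `[−1,1]`. [folklore] -/
theorem deriv_T_mem {u : ℝ} (hu : u ∈ Icc (-1 : ℝ) 1) :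
    0 ≤ deriv (fun x => T.eval x) u ∧ deriv (fun x => T.eval x) u ≤ 1 := by
  rw [deriv_T hT]
  have h0 : 0 ≤ 1 - u ^ 2 := by nlinarith [hu.1, hu.2]
  have h1 : 1 - u ^ 2 ≤ 1 := by nlinarith
  exact ⟨pow_nonneg h0 n, pow_le_one₀ h0 h1⟩

/-- `T` is monotone on `[−1,1]`. [folklore] -/
theorem T_monotoneOn : MonotoneOn (fun x => T.eval x) (Icc (-1 : ℝ) 1) :=
  monotoneOn_of_deriv_nonneg (convex_Icc _ _) T.differentiable.continuous.continuousOn T.differentiable.differentiableOn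
    fun _ hu => (deriv_T_mem hT (interior_subset hu)).1

/-- Slope at most `1`: `T y − T x ≤ y − x` for `x ≤ y` in `[−1,1]`. [folklore] -/
theorem T_sub_le {x y : ℝ} (hx : x ∈ Icc (-1 : ℝ) 1) (hy : y ∈ Icc (-1 : ℝ) 1) (hxy : x ≤ y) :
    T.eval y - T.eval x ≤ y - x := by
  have h := (convex_Icc (-1 : ℝ) 1).image_sub_le_mul_sub_of_deriv_le T.differentiable.continuous.continuousOn
    T.differentiable.differentiableOn (fun _ hu => (deriv_T_mem hT (interior_subset hu)).2) x hx y hy hxy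
  simpa using h

/-- **`T(1) ≤ 2/k`** for `n = k²`, `k ≥ 1` (and `T(0) = 0`). [folklore] -/
theorem T_one_le {k : ℕ} (hk : 1 ≤ k) (hn : n = k ^ 2) (hT0 : T.eval 0 = 0) : T.eval 1 ≤ 2 / k := by
  have hkpos : (0 : ℝ) < k := by exact_mod_cast hk
  have hk1 : (1 : ℝ) ≤ k := by exact_mod_cast hk
  have hik : (1 : ℝ) / k ≤ 1 := by rw [div_le_one hkpos]; exact hk1
  have hik0 : 0 < (1 : ℝ) / k := by positivity
  -- slope ≤ 1 on [0, 1/k]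
  have h1 : T.eval (1 / (k : ℝ)) ≤ 1 / k := by
    have := T_sub_le hT (x := 0) (y := 1 / (k : ℝ)) ⟨by norm_num, by norm_num⟩ ⟨by linarith, hik⟩ hik0.le
    rw [hT0] at this; linarith
  -- on [1/k, 1] the function v ↦ T v + 1/(k² v) is antitone
  have hn1 : 1 ≤ n := by rw [hn]; exact Nat.one_le_pow _ _ hk
  set g : ℝ → ℝ := fun v => T.eval v + ((k : ℝ) ^ 2)⁻¹ * v⁻¹ with hg
  have hgderiv : ∀ v, v ≠ 0 → HasDerivAt g ((1 - v ^ 2) ^ n + ((k : ℝ) ^ 2)⁻¹ * (-(v ^ 2)⁻¹)) v := by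
    intro v hv
    have h1 : HasDerivAt (fun x => T.eval x) ((1 - v ^ 2) ^ n) v := by
      have := T.hasDerivAt v
      rwa [hT, eval_pow, eval_sub, eval_one, eval_pow, eval_X] at this
    exact h1.add ((hasDerivAt_inv hv).const_mul _)
  have hanti : AntitoneOn g (Icc (1 / (k : ℝ)) 1) := by
    apply antitoneOn_of_deriv_nonpos (convex_Icc _ _)
    · intro v hv
      have hv0 : v ≠ 0 := by intro h; rw [h] at hv; linarith [hv.1]
      exact (hgderiv v hv0).continuousAt.continuousWithinAt
    · intro v hv
      have hv' := interior_subset hv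
      have hv0 : v ≠ 0 := by intro h; rw [h] at hv'; linarith [hv'.1]
      exact (hgderiv v hv0).differentiableAt.differentiableWithinAt
    · intro v hv
      have hv' := interior_subset hv
      have hv0 : 0 < v := lt_of_lt_of_le hik0 hv'.1
      rw [(hgderiv v hv0.ne').deriv]
      have hle := pow_le_inv hv0 hv'.2 hn1
      have : (1 : ℝ) / ((n : ℝ) * v ^ 2) = ((k : ℝ) ^ 2)⁻¹ * (v ^ 2)⁻¹ := by
        rw [hn]; push_cast; rw [one_div, mul_inv]
      rw [this] at hle
      linarith
  have hg1 : g 1 ≤ g (1 / k) := hanti ⟨le_refl _, hik⟩ ⟨hik, le_refl _⟩ hik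
  simp only [hg, inv_one, mul_one, one_div, inv_inv] at hg1
  have : ((k : ℝ) ^ 2)⁻¹ * k = 1 / k := by field_simp
  rw [this] at hg1
  have h1' : T.eval ((k : ℝ)⁻¹) ≤ 1 / k := by rw [← one_div]; exact h1
  have hk2 : 0 < ((k : ℝ) ^ 2)⁻¹ := by positivity
  calc T.eval 1 ≤ T.eval ((k : ℝ)⁻¹) + 1 / k - ((k : ℝ) ^ 2)⁻¹ := by linarith
    _ ≤ 1 / k + 1 / k - 0 := by linarith
    _ = 2 / k := by ring

/-- `|T u| ≤ T 1` on `[−1,1]` (odd and monotone). [folklore] -/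
theorem abs_T_le {u : ℝ} (hu : |u| ≤ 1) (hodd : ∀ x, T.eval (-x) = -T.eval x) : |T.eval u| ≤ T.eval 1 := by
  obtain ⟨hu1, hu2⟩ := abs_le.mp hu
  have hmono := T_monotoneOn hT
  rw [abs_le]
  constructor
  · have h := hmono (a := -1) (b := u) ⟨le_refl _, by norm_num⟩ ⟨hu1, hu2⟩ hu1
    have h1 : T.eval (-1) = -T.eval 1 := hodd 1
    simp only at h; linarith
  · exact hmono ⟨hu1, hu2⟩ ⟨by norm_num, le_refl _⟩ hu2

end softSignFacts

/-! ### The clipping polynomial `S = (63k/128)·T + X/64` -/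

/-- Derivative of `S`. [folklore] -/
theorem deriv_S {n : ℕ} {T : ℝ[X]} (hT : derivative T = (1 - X ^ 2) ^ n) (c : ℝ) (u : ℝ) :
    deriv (fun x => (Polynomial.C c * T + Polynomial.C (1 / 64) * X).eval x) u = c * (1 - u ^ 2) ^ n + 1 / 64 := by
  rw [Polynomial.deriv, derivative_add, derivative_C_mul, derivative_C_mul, hT, derivative_X]
  simp

/-- **The clipping polynomial has all four properties** (for `n = k²`, `c = 63k/128`). [folklore] -/
theorem clip_props {k n : ℕ} (hk : 1 ≤ k) (hn : n = k ^ 2) {T : ℝ[X]} (hT : derivative T = (1 - X ^ 2) ^ n)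
    (hT0 : T.eval 0 = 0) (hodd : ∀ x, T.eval (-x) = -T.eval x) :
    let S : ℝ[X] := Polynomial.C (63 / 128 * (k : ℝ)) * T + Polynomial.C (1 / 64) * X
    (∀ u : ℝ, |u| ≤ 1 → |S.eval u| ≤ 1) ∧
      (∀ u v : ℝ, |u| ≤ 1 → |v| ≤ 1 → |S.eval u - S.eval v| ≤ 2 * k * |u - v|) ∧
      (∀ u v : ℝ, -1 ≤ v → v ≤ u → u ≤ 1 → (u - v) / 64 ≤ S.eval u - S.eval v) ∧
      (∀ u v : ℝ, |u| ≤ 1 / (2 * k) → |v| ≤ 1 / (2 * k) → v ≤ u → k * (u - v) / 16 ≤ S.eval u - S.eval v) := by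
  intro S
  have hkpos : (0 : ℝ) < k := by exact_mod_cast hk
  have hk1 : (1 : ℝ) ≤ k := by exact_mod_cast hk
  have hSeval : ∀ u, S.eval u = 63 / 128 * k * T.eval u + u / 64 := by
    intro u; simp [S]; ring
  have hSd : ∀ u, deriv (fun x => S.eval x) u = 63 / 128 * k * (1 - u ^ 2) ^ n + 1 / 64 := deriv_S hT _
  have hScont : ∀ D : Set ℝ, ContinuousOn (fun x => S.eval x) D := fun D => S.differentiable.continuous.continuousOn
  have hSdiff : ∀ D : Set ℝ, DifferentiableOn ℝ (fun x => S.eval x) D := fun D => S.differentiable.differentiableOn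
  -- derivative bounds on [-1,1]
  have hlo : ∀ u ∈ interior (Icc (-1 : ℝ) 1), (1 : ℝ) / 64 ≤ deriv (fun x => S.eval x) u := by
    intro u hu
    have hu' := interior_subset hu
    rw [hSd]
    have : 0 ≤ (1 - u ^ 2) ^ n := pow_nonneg (by nlinarith [hu'.1, hu'.2]) n
    nlinarith
  have hhi : ∀ u ∈ interior (Icc (-1 : ℝ) 1), deriv (fun x => S.eval x) u ≤ 2 * k := by
    intro u hu
    have hu' := interior_subset hu
    rw [hSd]
    have h0 : 0 ≤ 1 - u ^ 2 := by nlinarith [hu'.1, hu'.2]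
    have : (1 - u ^ 2) ^ n ≤ 1 := pow_le_one₀ h0 (by nlinarith)
    nlinarith
  have hmono : ∀ u v : ℝ, -1 ≤ v → v ≤ u → u ≤ 1 →
      (u - v) / 64 ≤ S.eval u - S.eval v ∧ S.eval u - S.eval v ≤ 2 * k * (u - v) := by
    intro u v hv hvu hu
    have hvI : v ∈ Icc (-1 : ℝ) 1 := ⟨hv, hvu.trans hu⟩
    have huI : u ∈ Icc (-1 : ℝ) 1 := ⟨hv.trans hvu, hu⟩
    constructor
    · have h := (convex_Icc (-1 : ℝ) 1).mul_sub_le_image_sub_of_le_deriv (hScont _) (hSdiff _) hlo v hvI u huI hvu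
      linarith
    · exact (convex_Icc (-1 : ℝ) 1).image_sub_le_mul_sub_of_deriv_le (hScont _) (hSdiff _) hhi v hvI u huI hvu
  refine ⟨?_, ?_, fun u v hv hvu hu => (hmono u v hv hvu hu).1, ?_⟩
  · -- |S u| ≤ 1
    intro u hu
    rw [hSeval]
    have hT1 := T_one_le hT hk hn hT0
    have hTu := abs_T_le hT hu hodd
    obtain ⟨hu1, hu2⟩ := abs_le.mp hu
    obtain ⟨hTu1, hTu2⟩ := abs_le.mp hTu
    have hkT : k * T.eval 1 ≤ 2 := by
      have := mul_le_mul_of_nonneg_left hT1 hkpos.le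
      rwa [mul_div_cancel₀ _ hkpos.ne'] at this
    rw [abs_le]
    constructor <;> nlinarith
  · -- Lipschitz
    intro u v hu hv
    obtain ⟨hu1, hu2⟩ := abs_le.mp hu
    obtain ⟨hv1, hv2⟩ := abs_le.mp hv
    rcases le_total v u with h | h
    · rw [abs_of_nonneg (by linarith [(hmono u v hv1 h hu2).1]), abs_of_nonneg (by linarith)]
      exact (hmono u v hv1 h hu2).2
    · rw [abs_of_nonpos (by linarith [(hmono v u hu1 h hv2).1]), abs_of_nonpos (by linarith)]
      have := (hmono v u hu1 h hv2).2
      linarith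
  · -- the zone
    intro u v hu hv hvu
    have hzone : (1 : ℝ) / (2 * k) ≤ 1 := by
      rw [div_le_one (by positivity)]; linarith
    obtain ⟨hu1, hu2⟩ := abs_le.mp hu
    obtain ⟨hv1, hv2⟩ := abs_le.mp hv
    have hlo' : ∀ w ∈ interior (Icc (-(1 / (2 * (k : ℝ)))) (1 / (2 * k))), (k : ℝ) / 16 ≤ deriv (fun x => S.eval x) w := by
      intro w hw
      have hw' := interior_subset hw
      rw [hSd]
      have hw2 : w ^ 2 ≤ (1 / (2 * (k : ℝ))) ^ 2 := by
        rw [← sq_abs w]; exact pow_le_pow_left₀ (abs_nonneg w) (abs_le.mpr hw') 2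
      have hkw : (n : ℝ) * w ^ 2 ≤ 1 / 4 := by
        rw [hn]; push_cast
        calc (k : ℝ) ^ 2 * w ^ 2 ≤ (k : ℝ) ^ 2 * (1 / (2 * k)) ^ 2 := mul_le_mul_of_nonneg_left hw2 (by positivity)
          _ = 1 / 4 := by field_simp; ring
      have hw1 : w ^ 2 ≤ 1 := hw2.trans (by
        have := pow_le_one₀ (by positivity : (0 : ℝ) ≤ 1 / (2 * k)) hzone (n := 2); exact this)
      have hz := zone_pow_ge (n := n) hw1 hkw
      nlinarith
    have hvI : v ∈ Icc (-(1 / (2 * (k : ℝ)))) (1 / (2 * k)) := ⟨hv1, hv2⟩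
    have huI : u ∈ Icc (-(1 / (2 * (k : ℝ)))) (1 / (2 * k)) := ⟨hu1, hu2⟩
    have h := (convex_Icc _ _).mul_sub_le_image_sub_of_le_deriv (hScont _) (hSdiff _) hlo' v hvI u huI hvu
    linarith

end StubOuterPoly

open StubOuterPoly in
/-- **Stub `stub_outerPoly` of line `average-and-clip`** (registered signature, BY NAME): explicit outer clipping
polynomials `S_k = (63k/128)·T_{k²} + X/64` (soft sign `T_n`, `T_n' = (1 − X²)^n`) of degree `≤ 3k²`, bounded by
`1` on `[−1,1]`, `2k`-Lipschitz, slope `≥ 1/64`, and slope `≥ k/16` on `|u| ≤ 1/(2k)`. [folklore] -/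
theorem stub_outerPoly :
    ∃ (κ : ℕ) (K : ℝ), 0 < K ∧ ∀ k : ℕ, 1 ≤ k → ∃ S : Polynomial ℝ, (S.natDegree : ℝ) ≤ K * (k : ℝ) ^ κ ∧
      (∀ u : ℝ, |u| ≤ 1 → |S.eval u| ≤ 1) ∧
      (∀ u v : ℝ, |u| ≤ 1 → |v| ≤ 1 → |S.eval u - S.eval v| ≤ 2 * k * |u - v|) ∧
      (∀ u v : ℝ, -1 ≤ v → v ≤ u → u ≤ 1 → (u - v) / 64 ≤ S.eval u - S.eval v) ∧
      (∀ u v : ℝ, |u| ≤ 1 / (2 * k) → |v| ≤ 1 / (2 * k) → v ≤ u → k * (u - v) / 16 ≤ S.eval u - S.eval v) := by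
  refine ⟨2, 3, by norm_num, fun k hk => ?_⟩
  set n : ℕ := k ^ 2 with hn
  set T : ℝ[X] := ∑ j ∈ Finset.range (n + 1),
    C (((n.choose j : ℕ) : ℝ) * (-1) ^ j / (2 * j + 1)) * X ^ (2 * j + 1) with hTdef
  have hT : derivative T = (1 - X ^ 2) ^ n := derivative_softSign n
  have hT0 : T.eval 0 = 0 := softSign_eval_zero n
  have hodd : ∀ x, T.eval (-x) = -T.eval x := softSign_eval_neg n
  obtain ⟨h1, h2, h3, h4⟩ := clip_props hk hn hT hT0 hodd
  refine ⟨Polynomial.C (63 / 128 * (k : ℝ)) * T + Polynomial.C (1 / 64) * X, ?_, h1, h2, h3, h4⟩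
  -- degree ≤ 2k² + 1 ≤ 3k²
  have hdeg : (Polynomial.C (63 / 128 * (k : ℝ)) * T + Polynomial.C (1 / 64) * X).natDegree ≤ 2 * n + 1 := by
    refine (natDegree_add_le _ _).trans (max_le ?_ ?_)
    · exact (natDegree_C_mul_le _ _).trans (natDegree_softSign_le n)
    · exact (natDegree_C_mul_le _ _).trans (natDegree_X_le.trans (by omega))
  have hk1 : (1 : ℝ) ≤ k := by exact_mod_cast hk
  calc ((Polynomial.C (63 / 128 * (k : ℝ)) * T + Polynomial.C (1 / 64) * X).natDegree : ℝ)
      ≤ ((2 * n + 1 : ℕ) : ℝ) := by exact_mod_cast hdeg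
    _ = 2 * (k : ℝ) ^ 2 + 1 := by rw [hn]; push_cast; ring
    _ ≤ 3 * (k : ℝ) ^ 2 := by nlinarith

end Summit.QuantumAdvantage.QuantumAdvantage.Cruxes.VarianceAmplification.AverageAndClip

end
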